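import Summits.ResolutionOfSingularities.ResolutionOfSingularities.Theorems.HilbertSamuelEliminationSigmaMaxModificationsCorridor3SigmaSurfaceBadnessPointCureDrop
import Summits.ResolutionOfSingularities.ResolutionOfSingularities.Theorems.HilbertSamuelEliminationSigmaMaxModificationsCorridor3SigmaSurfaceBadnessCureNext
import HarnessLib

/-!
# [OURS · L1 W4.2] σ-LAYER PHASE B′ — `Corridor3SigmaSurfaceBadnessPointCureNext`: **`M` STRICTLY DROPS AT THE CURE-POINT STEP OF THE RUN** — under coincidence the
# filtered traces of `E.next C` on the next reduced surface, read on res-type-067's model `Bl_x D̃ ≅ D̃_next`, ARE the point-cured list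
# `(E.restrictOff ι_D).pointCure x ρ 𝓘_x`; hence at a counted same-member crossing `x` of an snc configuration (`ℓ(E, D) = 0`) of a surface
# `M(E.next C, surfaceNext (blowup.π C) C D) < M(E, D)`. With `…CureNext` (cure-curve step) and p548141/p555284 (ℓ) this completes the descent of `lex(ℓ, M)` along the
# three B′ steps of the (P1*) oracle of record
# (RULING v3.14-43 (KN) (R-a); res-L1-w42-stub-1 DESIGN CHECK 2 (b)(c); crux chain w42 `SigmaMaxModifications` stmt-ResolutionOfSingularities-18506 / conjunct
# `SigmaMaxModificationsCorridor3` stmt-ResolutionOfSingularities-19249; helper of res-L1-w42-stub-1 (gen 6), `--supports stmt-…-19249 --as helper`, counted 0)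

HONEST FRAMING. OURS bookkeeping assembled from res-type-067's member laws (`comap_strictTransformHom_controlledTransform`, `comap_strictTransformHom_exceptional`,
`exists_iso_menuCentre_surfaceNext`, `Boundary.restrictOff_map_comap`), the coincidence HYPOTHESIS `Boundary.Coincides` (o1/060's (D1′) run invariant), this seat's
p548141 point core and the carrier law `Boundary.badness_pointCure_lt` (`…PointCureDrop`). NOTHING here is a statement of H. Hironaka's manuscript [Hironaka2017] nor of
[CossartJannsenSaito2020]; no named fact. AI-written; AI review is weaker than expert review.

## Contents (namespace `…Theorems.SigmaMaxModificationsCorridor3.Sigma`)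

* `comap_strictTransformHom_memberTransform_eq_pointCureMember` (member by member), **`restrictOff_next_strictTransformHom_eq_pointCure`** (the list identity),
  **`badOfRecord_next_eq_badness_pointCure`**, **`badOfRecord_next_lt_of_pointCure`**.

VACUITY SELF-CHECK. Hypotheses: irreducible `D` with Noetherian regular reduced surface `D̃` of dimension `≤ 2`, `S(E, D)` snc, members locally principal, coincidence,
centre `C = 𝓘(ι x)` at a counted crossing `x ∈ crossingPts Γ₀` (so `x` is a closed point of codimension two) — the cure-POINT branch of (P1*).
-/

noncomputable section

set_option linter.dupNamespace false -- mandated namespace of this single-conjunct summit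

open CategoryTheory AlgebraicGeometry TopologicalSpace IsLocalRing
open Summit.ResolutionOfSingularities.ResolutionOfSingularities.Theorems.CampaignW42
open Literature.AlgebraicGeometry.Resolution Literature.RingTheory.HilbertSamuel

namespace Summit.ResolutionOfSingularities.ResolutionOfSingularities.Theorems.SigmaMaxModificationsCorridor3.Sigma

universe u

open Scheme.IdealSheafData

/-! ## The list identity along the comparison morphism -/

section ListIdentity

variable {W D DZ : Scheme.{u}} [IsLocallyNoetherian W] {ι : D ⟶ W} [IsClosedImmersion ι] {C : W.IdealSheafData} {E : Boundary W} {x : D}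
  {hxc : IsClosed ({x} : Set D)} {hxW : IsClosed ({ι.base x} : Set W)} {ρ : DZ ⟶ D}

omit [IsLocallyNoetherian W] in
/-- **MEMBER BY MEMBER** (point centre): along the comparison `j : Bl_x D̃ ⟶ Bl_C W`, the transform of a coinciding member restricts to the POINT-CURED trace:
`σᶜ(B,1)|' = ρᶜ(B|_{D̃}, 1)` on the member (CJS 4.8 (a)), `π^*B|' = ρ^*(B|_{D̃})` off it. [folklore] -/
theorem comap_strictTransformHom_memberTransform_eq_pointCureMember [IsLocallyNoetherian (blowup C)] [IsLocallyNoetherian DZ]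
    (hC : C = vanishingIdeal ⟨{ι.base x}, hxW⟩) (hρ : IsBlowup ρ (C.comap ι)) {B : W.IdealSheafData} (hB : Boundary.MemberCoincides C B) :
    (Boundary.memberTransform C B).comap ((blowup.isBlowup C).strictTransformHom hρ) = pointCureMember x ρ (vanishingIdeal ⟨{x}, hxc⟩) (B.comap ι) := by
  have hπ := blowup.isBlowup C
  have hsq := hπ.strictTransformHom_comp hρ
  have hCι : C.comap ι = vanishingIdeal ⟨{x}, hxc⟩ := by rw [hC]; exact comap_subschemeι_vanishingIdeal_singleton ι hxc hxW
  rw [(Boundary.memberCoincides_iff C B).mp hB]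
  by_cases hBC : B ≤ C
  · have hxB : x ∈ ((B.comap ι).support : Set D) := by
      have h1 : x ∈ ((C.comap ι).support : Set D) := by
        rw [hCι, coe_support_pointIdeal]; exact Set.mem_singleton x
      exact Scheme.IdealSheafData.support_antitone (Scheme.IdealSheafData.comap_mono (f := ι) hBC) h1
    rw [principalStrictTransform_of_le hBC, comap_strictTransformHom_controlledTransform hπ hρ (μ := 1) (by rwa [pow_one]), hCι, pointCureMember_of_mem hxB]
  · have hxB : x ∉ ((B.comap ι).support : Set D) := by
      intro h
      apply hBC
      rw [hC, ← Scheme.IdealSheafData.le_support_iff_le_vanishingIdeal]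
      change ({ι.base x} : Set W) ⊆ (B.support : Set W)
      rw [Boundary.coe_support_comap] at h
      exact Set.singleton_subset_iff.mpr h
    rw [principalStrictTransform_of_not_le hBC, ← Scheme.IdealSheafData.comap_comp, hsq, Scheme.IdealSheafData.comap_comp, pointCureMember_of_not_mem hxB]

open scoped Classical in
/-- **THE LIST IDENTITY** (point centre): under coincidence, `(E.next C).restrictOff j = (E.restrictOff ι).pointCure x ρ 𝓘_x`. [folklore] -/
theorem restrictOff_next_strictTransformHom_eq_pointCure [IsLocallyNoetherian (blowup C)] [IsLocallyNoetherian DZ]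
    (hC : C = vanishingIdeal ⟨{ι.base x}, hxW⟩) (hρ : IsBlowup ρ (C.comap ι)) (hcoin : E.Coincides C)
    (hlift : ∀ y : D, y ≠ x → ∃ z : DZ, ρ.base z = y) (hDd : Dense ({x}ᶜ : Set D)) (hZd : Dense ((ρ.base ⁻¹' {x})ᶜ : Set DZ)) :
    (E.next C).restrictOff ((blowup.isBlowup C).strictTransformHom hρ) = (E.restrictOff ι).pointCure x ρ (vanishingIdeal ⟨{x}, hxc⟩) := by
  have hπ := blowup.isBlowup C
  have hsq := hπ.strictTransformHom_comp hρ
  set j := hπ.strictTransformHom hρ with hj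
  have hCι : C.comap ι = vanishingIdeal ⟨{x}, hxc⟩ := by rw [hC]; exact comap_subschemeι_vanishingIdeal_singleton ι hxc hxW
  have hCs : (C.support : Set W) = {ι.base x} := by rw [hC]; exact Scheme.IdealSheafData.coe_support_vanishingIdeal _
  unfold Boundary.restrictOff Boundary.pointCure
  rw [Boundary.next_eq_map_memberTransform, List.filter_append, List.map_append]
  refine congrArg₂ (· ++ ·) ?_ ?_
  · rw [List.filter_map, List.map_map, List.map_map]
    refine List.filter_map_congr_aux E (pointCureMember x ρ (vanishingIdeal ⟨{x}, hxc⟩) ∘ fun I => I.comap ι) ((fun I => I.comap j) ∘ Boundary.memberTransform C)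
      (fun I => ¬ Set.range ι.base ⊆ (I.support : Set W)) ((fun I => ¬ Set.range j.base ⊆ (I.support : Set ↥(blowup C))) ∘ Boundary.memberTransform C)
      (fun B _ => ?_) (fun B hB _ => ?_)
    · simp only [Function.comp_apply]
      exact not_congr (range_subset_support_iff_of_isSupportTransform hsq hCs hlift hDd hZd (isSupportTransform_strictTransformIdeal C B))
    · simp only [Function.comp_apply]
      exact comap_strictTransformHom_memberTransform_eq_pointCureMember hC hρ (hcoin B hB)
  · have hkeep : ¬ Set.range j.base ⊆ ((C.comap (blowup.π C)).support : Set ↥(blowup C)) := not_range_subset_support_exceptional hsq hCs hlift hDd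
    rw [List.filter_singleton]
    simp only [hkeep, not_false_eq_true, decide_true, cond_true, List.map_singleton]
    rw [comap_strictTransformHom_exceptional hπ hρ, hCι]

end ListIdentity

/-! ## Run level: `M` at the cure-point step -/

section Run

variable {W : Scheme.{u}} [IsLocallyNoetherian W] {E : Boundary W} {D : Closeds W} {C : W.IdealSheafData}

/-- **`M(E.next C, D_next)` IS THE BADNESS OF THE POINT-CURED LIST** at a point step `C = 𝓘(ι x)` (`x` a closed point of codimension two of the regular reduced surface
of an irreducible `D`), under coincidence, on the model `ρ = Bl_{𝓘_x} D̃`. [folklore] -/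
theorem badOfRecord_next_eq_badness_pointCure (hDirr : IsIrreducible (D : Set W)) (hcoin : E.Coincides C)
    {x : ↥(menuCentre D).subscheme} (hxc : IsClosed ({x} : Set ↥(menuCentre D).subscheme)) (hx2 : Order.coheight x = 2)
    (hxW : IsClosed ({(menuCentre D).subschemeι.base x} : Set W)) (hC : C = vanishingIdeal ⟨{(menuCentre D).subschemeι.base x}, hxW⟩) :
    badOfRecord (blowup C) (E.next C) (surfaceNext (blowup.π C) C D) =
      ((E.restrictOff (menuCentre D).subschemeι).pointCure x (blowup.π (C.comap (menuCentre D).subschemeι)) (vanishingIdeal ⟨{x}, hxc⟩)).badness := by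
  haveI : IsProper (blowup.π C) := (blowup.isBlowup C).isProper
  haveI : IsLocallyNoetherian (blowup C) := LocallyOfFiniteType.isLocallyNoetherian (blowup.π C)
  set ι := (menuCentre D).subschemeι with hι
  haveI : IsIntegral (menuCentre D).subscheme := isIntegral_subscheme_vanishingIdeal D hDirr
  haveI : IsLocallyNoetherian (menuCentre D).subscheme := LocallyOfFiniteType.isLocallyNoetherian ι
  have hπ := blowup.isBlowup C
  have hCι : C.comap ι = vanishingIdeal ⟨{x}, hxc⟩ := by rw [hC]; exact comap_subschemeι_vanishingIdeal_singleton ι hxc hxW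
  have hρ := blowup.isBlowup (C.comap ι)
  have hρ' : IsBlowup (blowup.π (C.comap ι)) (vanishingIdeal ⟨{x}, hxc⟩) := by rw [← hCι]; exact hρ
  set ρ := blowup.π (C.comap ι) with hρdef
  haveI : IsProper ρ := hρ.isProper
  haveI : IsLocallyNoetherian (blowup (C.comap ι)) := LocallyOfFiniteType.isLocallyNoetherian ρ
  haveI : IsIntegral (blowup (C.comap ι)) := hρ'.isIntegral (pointIdeal_ne_bot hxc hx2)
  obtain ⟨e, he⟩ := exists_iso_menuCentre_surfaceNext (Z := D) hπ hρ
  -- side conditions of the point core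
  have hPx := coe_support_pointIdeal hxc
  have hlift : ∀ y : ↥(menuCentre D).subscheme, y ≠ x → ∃ z, ρ.base z = y := fun y hy => exists_base_eq_of_ne hρ' hPx hy
  have hDd : Dense ({x}ᶜ : Set ↥(menuCentre D).subscheme) :=
    hxc.isOpen_compl.dense ⟨genericPoint _, genericPoint_ne_of_coheight_eq_two hx2⟩
  have hZd : Dense ((ρ.base ⁻¹' {x})ᶜ : Set ↥(blowup (C.comap ι))) := by
    refine (hxc.preimage ρ.continuous).isOpen_compl.dense ?_
    obtain ⟨y, hy⟩ := hDd.nonempty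
    obtain ⟨z, hz⟩ := hlift y hy
    exact ⟨z, fun h => hy (by rw [Set.mem_preimage, hz, Set.mem_singleton_iff] at h; exact h)⟩
  rw [badOfRecord_eq, ← Boundary.badness_restrict_of_iso e.hom, Boundary.restrict, Boundary.restrictOff_map_comap _ _ e.hom, he,
    restrictOff_next_strictTransformHom_eq_pointCure hC hρ hcoin hlift hDd hZd]

/-- **`M` STRICTLY DROPS AT THE CURE-POINT STEP OF THE RUN**: irreducible `D` with Noetherian regular reduced surface `D̃` of dimension `≤ 2`, `S(E, D)` snc
(`ℓ(E, D) = 0`), boundary members locally principal, coincidence, and centre `C = 𝓘(ι x)` at a COUNTED same-member crossing `x ∈ crossingPts Γ₀` (`Γ₀` a filtered trace)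
⇒ `M(E.next C, surfaceNext (blowup.π C) C D) < M(E, D)`. [folklore] -/
theorem badOfRecord_next_lt_of_pointCure [IsNoetherian (menuCentre D).subscheme] (hDirr : IsIrreducible (D : Set W))
    (hreg : Scheme.IsRegular (menuCentre D).subscheme) (hdim : topologicalKrullDim ↥(menuCentre D).subscheme ≤ 2)
    (hS : IsStrictNormalCrossingsDivisor (menuCentre D).subscheme (surfaceTraceSet E D)) (hE : ∀ B ∈ E, IsLocallyPrincipal B) (hcoin : E.Coincides C)
    {Γ₀ : ((menuCentre D).subscheme).IdealSheafData} (hΓ₀ : Γ₀ ∈ E.restrictOff (menuCentre D).subschemeι) {x : ↥(menuCentre D).subscheme}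
    (hx : x ∈ (E.restrictOff (menuCentre D).subschemeι).crossingPts Γ₀) (hxW : IsClosed ({(menuCentre D).subschemeι.base x} : Set W))
    (hC : C = vanishingIdeal ⟨{(menuCentre D).subschemeι.base x}, hxW⟩) :
    badOfRecord (blowup C) (E.next C) (surfaceNext (blowup.π C) C D) < badOfRecord W E D := by
  set ι := (menuCentre D).subschemeι with hι
  haveI : IsIntegral (menuCentre D).subscheme := isIntegral_subscheme_vanishingIdeal D hDirr
  have h2 := coheight_le_two_of_topologicalKrullDim_le hdim
  have hx2 : Order.coheight x = 2 := coheight_eq_two_of_mem_crossingPts h2 hx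
  -- `x` is a closed point (maximal codimension)
  have hxc : IsClosed ({x} : Set ↥(menuCentre D).subscheme) := by
    rw [← closure_eq_iff_isClosed]
    refine Set.Subset.antisymm (fun y hy => ?_) subset_closure
    rw [← specializes_iff_mem_closure] at hy
    have hfin : Order.coheight y ≠ ⊤ := ne_top_of_le_ne_top (by decide) (h2 y)
    exact Set.mem_singleton_iff.mpr (eq_of_specializes_of_coheight_le hy hfin (by rw [hx2]; exact h2 y)).symm
  have hCι : C.comap ι = vanishingIdeal ⟨{x}, hxc⟩ := by rw [hC]; exact comap_subschemeι_vanishingIdeal_singleton ι hxc hxW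
  have hρ := blowup.isBlowup (C.comap ι)
  have hρ' : IsBlowup (blowup.π (C.comap ι)) (vanishingIdeal ⟨{x}, hxc⟩) := by rw [← hCι]; exact hρ
  haveI : IsProper (blowup.π (C.comap ι)) := hρ.isProper
  haveI : IsLocallyNoetherian (blowup (C.comap ι)) := LocallyOfFiniteType.isLocallyNoetherian (blowup.π (C.comap ι))
  haveI : IsIntegral (blowup (C.comap ι)) := hρ'.isIntegral (pointIdeal_ne_bot hxc hx2)
  rw [badOfRecord_next_eq_badness_pointCure hDirr hcoin hxc hx2 hxW hC, badOfRecord_eq]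
  exact Boundary.badness_pointCure_lt hρ' hreg (ne_bot_of_mem_restrictOff (E := E)) (isLocallyPrincipal_of_mem_restrictOff hE) hS h2 hΓ₀ hx

end Run

end Summit.ResolutionOfSingularities.ResolutionOfSingularities.Theorems.SigmaMaxModificationsCorridor3.Sigma

end
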